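import Literature.MathematicalPhysics.QuantumFieldTheory.Balaban1983to89.B9Eq3105FamThreeAtLocCfg
import Literature.MathematicalPhysics.QuantumFieldTheory.Balaban1983to89.B9Eq3105FamThreeTCover

/-!
# `Balaban1983to89.B9Eq3105FamThreeTAtLocCfg` — THE TRANSPOSED (`hV′`) FAMILY 3 OF (3.105) AT THE LOCATED LETTERS OF RECORD: the consumer's `hV′` summand
# `Σ_□ conj b((M_{h_□}·O_□(U₁)·M_{h_□}·(M_{ζ_□̃}·(DPD*(U₁) − Pl_□)))^ℝ)` with `Pl_□ = R(u_□)⁻¹·DP_□D*(Ṽ_□)·R(u_□)` (G-F2's transported cube projection), the ζ of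
# record `zetaY`, and the (3.35) window `U₁^{u_□} = Ṽ_□` near □ — ASSEMBLED from F3-D2 (cover + far pieces + Z2-P's `P`-majorant), F3-B (the member words at the
# SWAPPED pair `(h_□, ζ_□̃)`) and F3-P's window geometry, so that the transposed family 3 is CLOSED AT THE LETTERS modulo exactly: the located `G′`-difference
# entries `hDL`∕`hDR` (memo D1), the (3.49)₄ entry `hP3` of the located `C`-difference word (memo D2, typed), the cube datum `hPlC` ((3.49) for `DP_□D*(Ṽ_□)` on
# the cube carrier, D2a's shape) and the letters' blocks `hE`∕`hEO`∕`hCinv` (sub-row G-B9-LETTERS, GAPS G-B9-05∕family 3, programme FAMTHREE FILE F3-PT — the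
# `hV′` twin of p33's F3-P `B9Eq3105FamThreeAtLocCfg`; lead g34 RULINGS FAMTHREE ∕ FAMTHREE-2; division p38 g47 ∕ p33 g103 2026-08-29)

statement-level skeleton of published theorems with citation tags; proofs where landed; nothing here is a claim about the Yang–Mills mass gap

THE PRINTED LOCUS (verbatim, held `paper:balaban1985-cmp99-background-propagators`, journal page = PDF page + 388).  p. 414 (3.105), third sum:
«− Σ_□ ζ_□̃(DPD* − DP_□D*)h_□G_□h_□ … where the function ζ_□̃ is defined similarly to h_□, i.e. ζ_□̃ ∈ C₀^∞(□̃) and ζ_□̃ = 1 on a cube containing □»; (3.106)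
p. 414 «G = G₀(I − R)⁻¹ = Σ_{n=0}^∞ G₀Rⁿ.» (the tree's `hV′` is M5.7's device: the expansion multiplied from the right — not a printed sentence); p. 415 l.29–37:
«Next we replace the operators G′_{□₀} and C_{□₀} by G′_□, C_□, terms with the differences G′_{□₀} − G′_□ and C_{□₀} − C_□ are small by the same reason as
before. … Using the fact that ζ_□̃h_□ = h_□ … This expression cancels the second term in the third sum.»; p. 415 l.21–24 («localizations introduced by 1 − ζ_□̃
and h_□ are separated by a distance ≥ M»); Cor. 3.6 p. 408 («U′ = U^u = e^{iηA}» on `Ω(□)`); (3.33)–(3.34) p. 396; (3.49) p. 399; p. 412 l.22–36; p. 399 l.19–24;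
(3.87) p. 409; (3.91) p. 410; [4] (2.51)–(2.55) p. 232, (2.83)–(2.85) pp. 237–238, Lemma 2.1 (2.60)–(2.61) p. 234; [2] = `Balaban1983RegularityDecay`, (1.11)–(1.12).

WHY THIS FILE.  F3-D2 (`B9Eq3105FamThreeTCover.hasMajorant_sum_famThreeT_zetaY_of_near_closedP`) reduced the consumer's `hV′` family-3 summand to, per cube, the
NEAR binder `hXn □ : conj b((M_{h_□}·(DPD*(U₁) − Pl □)·M_{ζ_□̃})^ℝ) ≺ K_n·ℓ(a)⁻²·e^{−a_nδd}` and the cube datum `hPlC □`; F3-B (`B9Eq3105FamThreeMember.hasMajorant_famThree_located_of_cDiff`,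
GENERIC in the two cut-offs) supplies `hXn □` at the swapped pair `(ζ, h) := (h_□, ζ_□̃)` for `Pl □ := DPDsCubeY i □ parS V′_□` under the window `V′_□ = U₁` on
the bonds issued from `supp h_□♭ ∪ supp ζ_□̃♭`, modulo `hDL`∕`hDR` and the located `C`-difference word.  THIS FILE puts the consumer's letters in, exactly as p33's
F3-P did for the `hrest` word: `V′_□ := Ṽ_□^{u_□⁻¹}` (so `Pl □ = locProjBY i □ parS u_□ Ṽ_□`, F3-A `locProjBY_eq_DPDsCubeY`), the window DISCHARGED from the
(3.35) agreement `U₁^{u_□} = Ṽ_□` within `2S_j` of the centre of `β` (F3-P `window_hTY`∕`window_zetaY` — symmetric in the pair), and the `C`-difference word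
displayed in print's (3.49)₄ dress (`hP3 □`, F3-P `hasMajorant_cDiffWord_located_of_entry` — generic in `(ζ, h)`, so the SAME `hP3 □` serves `hrest` and `hV′`).

WHAT THIS FILE CERTIFIES (kernel-checked; 0 `def`, 0 `def … : Prop`, 0 sorry; standard axioms only)

* §1 ★★★ `hasMajorant_sum_famThreeT_at_locLetters` — THE `hV′` FAMILY-3 SUMMAND AT THE LETTERS: for a gauge-law `parS`, bi-contractive gauges `u_□`, fields
  `Ṽ_□` agreeing with `U₁^{u_□}` on `NearC 2S_j` (site form), any per-cube plateau cut-offs `χ_□` (`= 1` on the gradient stencils of `supp ζ_□̃♭ ∪ supp h_□♭`),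
  the ζ of record and `Pl □ = locProjBY i □ parS (u □) (Ṽ □)`:
  `Σ_□ conj b((M_{h_□}·Oc □ U₁·M_{h_□}·(M_{ζ_□̃}·(DPDsY parS G′ U₁ − Pl □)))^ℝ) ≺ 3·5^{d+1}·((M₂Σ‖b_j‖B₀)·K_T·Λ′·c₁(δ, ρ₁ − ρ′))·e^{−ρ′δ·d(a,b′)}`,
  `K_T = (κ_F3(ε_D) + ε₃) + (κ₃₄₉ + (M₂Σ‖b_j‖)²K_Cc₁(δ_C, α_C))·e^{−a_sep·δ·D_sep}`, over `(toB6 (geo9K i) Rr Hp, ιB∘blkV1)`, modulo: `hDL □`∕`hDR □` (located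
  `G′`-difference entries at `χ_□`, constant `ε_D`), `hP3 □` (the located `C`-difference word's (3.49)₄ entry, constant `ε₃`), `hPlC □` (the cube datum
  `conj b(DP_□D*(Ṽ_□)^ℝ) ≺ K_C·ℓ_□(a)⁻²·e^{−δ_Cd_□}` on `(toB6 (geoCK i □) RC HC, blkBK)` — D2a `B9Cor36DPDsCubeAtLocCfg`'s shape), `hE` ((3.42) of `G′(U₁)`), `hEO`
  (the `O_□`), `hCinv` ((3.48)), bi-contractive `parS`, `η = |c_f|⁻¹`, the member (2.61) at `(δ₀, β′)` and `(δ, ρ₁ − ρ′)`, the cube (2.61) at `(δ_C, α_C)`, the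
  transfers of `ℓ, ℓ², ℓ⁻⁴` at `δ₀` and of `ℓ⁻²` at `δ`, and the budgets `a_sep + ρ₁ ≤ ρ∕δ`, `(a_sep + ρ₁)δ ≤ (1 − α_C)δ_C`, `α_st + ρ′ ≤ 1`;
  ★★ `hasMajorant_sum_famThreeT_at_locCfg` — the same at `Ṽ_□ := locCfgY i □ η (A □)`, `parS := parSymY i`, `χ_□ := chiY i □`, the plateau hypotheses and the
  site agreement DISCHARGED (`B9Eq3105FamThreeCore` §2; the (3.35) datum's `hQ`∕`hgA`, F3-P `agree_of_datum`).

HONEST SCOPE ∕ NOT CLAIMED.  The transposed family 3 of (3.105) (the `hV′` side) is hereby CLOSED AT THE LETTERS MODULO: (D1) the located `G′`-difference entries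
`hDL`∕`hDR` and (D2) the (3.49)₄ entry `hP3` of the located `C`-difference word — both `hD`-species inputs with explicit constants and supplier NONE (GAPS G-B9-05;
print: «small by the same reason as before», p. 415, = O(e^{−2δ₀M}) by [2] (1.11)–(1.12), p. 412 l.22–36) —, (D2a) the cube datum `hPlC □` for `DP_□D*(Ṽ_□)`
(supplier: `B9Cor36DPDsCubeAtLocCfg.hasMajorant_conj_DPDsCubeY_at_locCfg` above its ∃-thresholds, at `η = (kGeo i).eta` — NOT invoked here), plus the letters'
blocks `hE`, `hEO`, `hCinv`, bi-contractivity of `parS` and `u_□`, `η = |c_f|⁻¹`, the member ∕ cube (2.61), the transfers, exactly as Z2-P ∕ F3-C ∕ F3-D display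
them.  The conclusion is FLAT (`N·(Θ·e^{−ρ′δd})`); `hV′`'s currency `Θ′·ℓ(a)·ℓ(a′)⁻¹·e^{−(1−α_m)ρ′δd}` is one application of F3-D2 §4
`B9Eq3105FamThreeTCover.hasMajorant_src_of_flat` under the transfer of `ℓ` (not restated here).  NOT here: the `hrest` word (F3-P), families 2 and 4, the knit into
`hV′`, `hsmallV`.  Count-neutral; NOT a node discharge; no summit ∕ sub-problem
statement is proved; nothing continuum ∕ OS ∕ mass-gap ∕ Clay; YM mass gap NOT proved (Track A conditional rung).  No `sorry`, no `axiom`, no `… : Prop` fact,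
no `instance`, no `notation`, no `def`.  NEW file; nothing landed is modified.  Cell `lit-balaban`, seat `lit-balaban-p38` gen 47, 2026-08-29; `--supports
stmt-QuantumFields-19200` as helper.  Net new unproved facts: 0.

RELATED IN THE TREE, NOT DUPLICATED (searched 2026-08-29: `rg 'famThreeT_at_loc' Literature/` = ∅): p33 F3-P `B9Eq3105FamThreeAtLocCfg` (the `hrest` twin —
pattern; `window_hTY`, `window_zetaY`, `agree_of_datum`, `hasMajorant_cDiffWord_located_of_entry` USED BY NAME), F3-B `B9Eq3105FamThreeMember.hasMajorant_famThree_located_of_cDiff`,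
F3-D2 `B9Eq3105FamThreeTCover.hasMajorant_sum_famThreeT_zetaY_of_near_closedP`, F3-A `B9Eq3105FamThreeLetters.locProjBY_eq_DPDsCubeY`, `B9Eq3105FamThreeCore` §2
(`chiY_eq_one_of_hTY_gradK`, `chiY_eq_one_of_zetaY_gradK`), `B9Eq3105ZetaY`, def-Y `Node00.parSymY_isGaugeLawS` — all USED BY NAME.
-/

noncomputable section

namespace Literature.MathematicalPhysics.QuantumFieldTheory.Balaban1983to89.B9Eq3105FamThreeTAtLocCfg

open NormedSpace Complex
open B6RandomWalk (HasMajorant hasMajorant_mono Ineq261 c1_nonneg)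
open B9FromB6 (EBlock)
open B9Thm34Ext (toB6)
open B9Ineq347 (ScaleTransfer)
open B9Eq352DivFormLetters (conj)
open B9Eq352GradLetters (diffLetter)
open B6KLevelCensusIndexV1 (KIdx)
open B6Cover236MultiLevelBlocks (cubes)
open B6GlobalChartV1 (blkV1 PV boxEquiv)
open B6Geom246MultiLevelBox (blkOf)
open B6Ineq2142KLevelV1 (β)
open B9GeoNormsKLevelV1 (geo9K)
open B9GeoLemma21KLevelV1 (one_le_Mh)
open B9Eq39Adjoint (fluct)
open B9Eq360DeltaPrimeAY (AfldY)
open B9Thm37CubeCoverCommutators (cutMulY hTY)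
open B9Eq3104CutoffCommutators (hBdY DPDsY)
open B9Eq3105AtLetters (DPDsCubeY)
open B9Eq3105ZetaY (zetaY abs_hBdY_zetaY_le_one)
open B9Eq3105FamThreeLetters (locProjBY_eq_DPDsCubeY)
open B9Eq3105FamThreeCore (chiY_eq_one_of_zetaY_gradK chiY_eq_one_of_hTY_gradK)
open B9Eq3105FamThreeMember (hasMajorant_famThree_located_of_cDiff)
open B9Eq3105FamThreeAtLocCfg (window_zetaY window_hTY agree_of_datum hasMajorant_cDiffWord_located_of_entry)
open B9Eq3105FamThreeTCover (hasMajorant_sum_famThreeT_zetaY_of_near_closedP)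
open B9CubeLettersOpsL0 (GpCubeY)
open B9CubeLettersBondOpsL0 (QpCubeY QpsCubeY XinvCubeY)
open B9CubeLettersInvReadings (kernelFamilySInv kernelFamilyBInv)
open B9CubeGeometryInputs (geoCK)
open B9Cor35GCubeInputsAtOne (blkBK)
open B9Cor36CubeCutoffs (SC NearC locCfgY)
open B9Cor36GCubeLocLetter (locProjBY)
open B9Thm39CinvAtCover (DsepT)
open B9Ineq368PPrime (kappa349)
open Node00 (SiteY BlkY IBondY FBondY CfgY GaugeY SiteOpY BondOpY SiteParY BondParY toKT etaS shiftY UboxY QpY QpsY XinvY gradY divY gradK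
  gaugeY parSymY parSymY_isGaugeLawS IsGaugeLawS)

variable {d ℓ : ℕ} {hd : 1 ≤ d + 1} {hL : Odd (ℓ + 1) ∧ 1 < ℓ + 1} {b₀ b₁ : ℝ}
variable {𝔸 : Type} [NormedRing 𝔸] [NormedAlgebra ℂ 𝔸] [CompleteSpace 𝔸]
variable {ι : Type} [Fintype ι]
variable (i : KIdx d ℓ hd hL b₀ b₁) (b : Module.Basis ι ℝ 𝔸)

/-! ## §1  The `hV′` family-3 summand at the located letters -/

section AtLetters

variable [Fintype (geo9K i).Site] [DecidableEq (geo9K i).Site] {Rr : ℝ} {Hp : Prop}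
variable {B : B9.Backgrounds} (cfg : B.Cfg → CfgY 𝔸 i) (Gp : SiteOpY 𝔸 i) (parS : SiteParY 𝔸 i) (par : BondParY 𝔸 i) {U₁ : B.Cfg}

set_option maxHeartbeats 6400000 in
/-- ★★★ **THE TRANSPOSED FAMILY 3 OF (3.105), THE `hV′` SUMMAND, AT THE LOCATED LETTERS** — for a gauge-law `parS`, bi-contractive gauges `u_□`, fields `Ṽ_□`
with the site agreement `UboxY (U₁^{u_□}) = UboxY Ṽ_□` on `NearC 2S_j` (the (3.35) window), per-cube plateau cut-offs `χ_□`, the ζ of record and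
`Pl □ = locProjBY i □ parS (u □) (Ṽ □)`:
`Σ_□ conj b((M_{h_□}·Oc □ U₁·M_{h_□}·(M_{ζ_□̃}·(DPDsY parS G′ U₁ − Pl □)))^ℝ) ≺ 3·5^{d+1}·((M₂Σ‖b_j‖B₀)·K_T·Λ′·c₁(δ, ρ₁ − ρ′))·e^{−ρ′δ·d(a,b′)}` over
`(toB6 (geo9K i) Rr Hp, ιB∘blkV1)`, `K_T = (κ_F3(ε_D) + ε₃) + (κ₃₄₉ + (M₂Σ‖b_j‖)²K_Cc₁(δ_C,α_C))·e^{−a_sep·δ·D_sep}`, MODULO: the located `G′`-difference entries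
`hDL □`∕`hDR □` at `χ_□` (constant `ε_D`), the (3.49)₄ entry `hP3 □` of the located `C`-difference word (constant `ε₃`), the cube datum `hPlC □` for `DP_□D*(Ṽ_□)`
(constant `K_C`, rate `δ_C`, cube carrier), `hE`, `hEO`, `hCinv`, bi-contractive `parS`, `η = |c_f|⁻¹`, the member (2.61) at `(δ₀, β′)` and `(δ, ρ₁ − ρ′)`, the cube
(2.61) at `(δ_C, α_C)`, the transfers.  The near piece is F3-B Member §5 at the SWAPPED pair `(h_□, ζ_□̃)` with F3-P's windows; the far pieces, the cover and
Z2-P's `P`-majorant are F3-D1∕F3-D2.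
[cite: Balaban1985BackgroundPropagators, (3.105)–(3.106) p.414, p.415 l.18–37, p.412 l.22–36, p.399 l.19–24, Cor. 3.6 p.408, (3.33)–(3.34) p.396, (3.49) p.399, (3.25) p.394, Thm 3.1 (3.42) p.397, Thm 3.2 (3.48) p.398, (3.87) p.409, (3.91) p.410; Balaban1983RegularityDecay, (1.11)–(1.12); Balaban1984PropagatorsII, (2.51)–(2.55) p.232, (2.83)–(2.85) pp.237–238, Lemma 2.1 (2.60)–(2.61) p.234] -/
theorem hasMajorant_sum_famThreeT_at_locLetters (hS : IsGaugeLawS i parS)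
    {BG δG : ℝ} (hE : EBlock (kernelFamilySInv i B cfg Gp parS) BG δG U₁) (hBG : 0 ≤ BG)
    (Oc : ↥(cubes i.D.toDomains) → BondOpY 𝔸 i) {B₀ δ : ℝ} (hB₀ : 0 ≤ B₀) (hδ : 0 < δ)
    (hEO : ∀ c : ↥(cubes i.D.toDomains), EBlock (kernelFamilyBInv i B cfg (Oc c) par) B₀ δ U₁)
    (ιB : BlkY i → IBondY i) (hι : ∀ s, β i.hN i.D i.hk (ιB s) = s)
    (hpar : ∀ z w : SiteY i, ‖(parS (cfg U₁) z w : 𝔸)‖ ≤ 1 ∧ ‖(((parS (cfg U₁) z w)⁻¹ : 𝔸ˣ) : 𝔸)‖ ≤ 1)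
    {M₂ : ℝ} (hM₂ : 0 ≤ M₂) (hrepr : ∀ (v : 𝔸) (j : ι), |b.repr v j| ≤ M₂ * ‖v‖) (hη : etaS i = |i.cf|⁻¹)
    {s B₁ δX : ℝ} (hs : (etaS i ^ 2 * etaS i ^ 2) * s = 1) (hB₁ : 0 ≤ B₁)
    (hCinv : HasMajorant (g := toB6 (geo9K i) Rr Hp) (fun q : BlkY i × ι => ιB q.1) (conj b (s • (XinvY i parS Gp (cfg U₁)).restrictScalars ℝ))
      (fun a a' => B₁ * ((geo9K i).len a ^ 4)⁻¹ * Real.exp (-(δX * (geo9K i).dist a a'))))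
    (u : ↥(cubes i.D.toDomains) → GaugeY 𝔸 i) (hu : ∀ c x, ‖((u c x : 𝔸ˣ) : 𝔸)‖ ≤ 1 ∧ ‖(((u c x)⁻¹ : 𝔸ˣ) : 𝔸)‖ ≤ 1)
    (V : ↥(cubes i.D.toDomains) → CfgY 𝔸 i)
    (hagree : ∀ (c : ↥(cubes i.D.toDomains)) (w : SiteY i), NearC i c (2 * SC i c) w.1 → ∀ κ : Fin (d + 1),
      UboxY i (gaugeY i (u c) (cfg U₁)) κ w = UboxY i (V c) κ w)
    (χ : ↥(cubes i.D.toDomains) → SiteY i → ℝ)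
    (hζχ : ∀ (c : ↥(cubes i.D.toDomains)) (f : FBondY i) (z : SiteY i), hBdY i (zetaY i c) f ≠ 0 → gradK i f z ≠ 0 → χ c z = 1)
    (hhχ : ∀ (c : ↥(cubes i.D.toDomains)) (f : FBondY i) (z : SiteY i), hBdY i (hTY i c) f ≠ 0 → gradK i f z ≠ 0 → χ c z = 1)
    {εD δD : ℝ} (hεD : 0 ≤ εD)
    (hDL : ∀ (c : ↥(cubes i.D.toDomains)) (μ : Fin (d + 1)), HasMajorant (g := toB6 (geo9K i) Rr Hp) (fun p : SiteY i × ι => ιB (blkOf i.D.toDomains p.1))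
      (conj b (diffLetter (shiftY i) (UboxY i (cfg U₁)) (((etaS i : ℝ) : ℂ))⁻¹ (Sum.inl μ)) *
        conj b ((etaS i ^ 2) • (cutMulY (𝔸 := 𝔸) (χ c) ∘ₗ
          (Gp (cfg U₁) - GpCubeY i c parS (gaugeY i (u c)⁻¹ (V c)))).restrictScalars ℝ))
      (fun a a' => εD * (geo9K i).len a * Real.exp (-(δD * (geo9K i).dist a a'))))
    (hDR : ∀ (c : ↥(cubes i.D.toDomains)) (ν : Fin (d + 1)), HasMajorant (g := toB6 (geo9K i) Rr Hp) (fun p : SiteY i × ι => ιB (blkOf i.D.toDomains p.1))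
      (conj b ((etaS i ^ 2) • ((Gp (cfg U₁) - GpCubeY i c parS (gaugeY i (u c)⁻¹ (V c))) ∘ₗ
          cutMulY (𝔸 := 𝔸) (χ c)).restrictScalars ℝ) *
        conj b (diffLetter (shiftY i) (UboxY i (cfg U₁)) (((etaS i : ℝ) : ℂ))⁻¹ (Sum.inr ν)))
      (fun a a' => εD * (geo9K i).len a * Real.exp (-(δD * (geo9K i).dist a a'))))
    (dB : ℕ) {δ₀ δP α β' ρ Λ : ℝ} (hΛ : 1 ≤ Λ) (hρ : 0 ≤ ρ) (hα : 0 ≤ α) (hβ : 0 ≤ β') (hδ₀ : 0 ≤ δ₀)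
    (hδG' : δP ≤ δG) (hδX' : δP ≤ δX) (hδD' : δP ≤ δD) (hr : ρ + (2 * α + β') * δ₀ ≤ δP)
    (h261 : Ineq261 dB (toB6 (geo9K i) Rr Hp) δ₀ β')
    (hT1 : ScaleTransfer (geo9K i) δ₀ α Λ (fun a => (geo9K i).len a)) (hT2 : ScaleTransfer (geo9K i) δ₀ α Λ (fun a => (geo9K i).len a ^ 2))
    (hT4 : ScaleTransfer (geo9K i) δ₀ α Λ (fun a => ((geo9K i).len a ^ 4)⁻¹))
    {ε₃ : ℝ} (hε₃ : 0 ≤ ε₃)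
    (hP3 : ∀ c : ↥(cubes i.D.toDomains), HasMajorant (g := toB6 (geo9K i) Rr Hp) (fun p : FBondY i × ι => ιB (blkV1 i.hN i.D p.1))
      (conj b ((gradY i (cfg U₁) ∘ₗ (cutMulY (𝔸 := 𝔸) (χ c) ∘ₗ
        (GpCubeY i c parS (gaugeY i (u c)⁻¹ (V c)) ∘ₗ ((QpsY i parS (cfg U₁) ∘ₗ XinvY i parS Gp (cfg U₁) ∘ₗ QpY i parS (cfg U₁))
            - (QpsCubeY i c parS (gaugeY i (u c)⁻¹ (V c)) ∘ₗ XinvCubeY i c parS (gaugeY i (u c)⁻¹ (V c)) ∘ₗ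
                QpCubeY i c parS (gaugeY i (u c)⁻¹ (V c)))) ∘ₗ GpCubeY i c parS (gaugeY i (u c)⁻¹ (V c))) ∘ₗ
        cutMulY (𝔸 := 𝔸) (χ c)) ∘ₗ divY i (cfg U₁)).restrictScalars ℝ))
      (fun a y => ε₃ * ((geo9K i).len a ^ 2)⁻¹ * Real.exp (-(ρ * (geo9K i).dist a y))))
    (RC : ℝ) (HC : Prop) (dC : ℕ) {KC δC αC : ℝ} (hKC : 0 ≤ KC) (hδC : 0 ≤ δC) (hαC1 : αC ≤ 1)
    (h261C : ∀ c : ↥(cubes i.D.toDomains), Ineq261 dC (toB6 (geoCK i c) RC HC) δC αC)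
    (hPlC : ∀ c : ↥(cubes i.D.toDomains), HasMajorant (g := toB6 (geoCK i c) RC HC) (blkBK i c)
      (conj b ((DPDsCubeY i c parS (V c)).restrictScalars ℝ))
      (fun a s' => KC * ((geoCK i c).len a ^ 2)⁻¹ * Real.exp (-(δC * (geoCK i c).dist a s'))))
    (dB' : ℕ) {asep ρ₁ ρ' αst Λ' : ℝ} (hasep : 0 ≤ asep) (hΛ' : 0 ≤ Λ') (hρ' : 0 ≤ ρ')
    (hsplitP : asep + ρ₁ ≤ ρ / δ) (hsplitC : asep * δ + ρ₁ * δ ≤ (1 - αC) * δC) (hsplit : αst + ρ' ≤ 1)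
    (h261' : Ineq261 dB' (toB6 (geo9K i) Rr Hp) δ (ρ₁ - ρ')) (hST : ScaleTransfer (geo9K i) δ αst Λ' (fun a => ((geo9K i).len a ^ 2)⁻¹)) :
    HasMajorant (g := toB6 (geo9K i) Rr Hp) (fun p : FBondY i × ι => ιB (blkV1 i.hN i.D p.1))
      (∑ c : ↥(cubes i.D.toDomains), conj b ((cutMulY (𝔸 := 𝔸) (hBdY i (hTY i c)) * Oc c (cfg U₁) * cutMulY (𝔸 := 𝔸) (hBdY i (hTY i c)) *
        (cutMulY (𝔸 := 𝔸) (hBdY i (zetaY i c)) * (DPDsY i parS Gp (cfg U₁) - locProjBY i c parS (u c) (V c)))).restrictScalars ℝ))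
      (fun a b' => (3 * 5 ^ (d + 1)) *
        (((M₂ * (∑ j, ‖b j‖) * B₀) *
            ((((M₂ * ∑ j, ‖b j‖) * (M₂ * ∑ j, ‖b j‖) * B₁ * Λ ^ 4 * B6.c1 dB δ₀ β' ^ 2 *
                  (((d : ℝ) + 1) * εD * (2 * (M₂ * (∑ j, ‖b j‖) * BG) + εD)) + ε₃) +
              (kappa349 (M₂ * ∑ j, ‖b j‖) (((d : ℝ) + 1) * (M₂ * (∑ j, ‖b j‖) * BG)) B₁ Λ (B6.c1 dB δ₀ β') +
                (M₂ * ∑ j, ‖b j‖) ^ 2 * (KC * B6.c1 dC δC αC)) * Real.exp (-(asep * δ * DsepT i)))) * Λ' * B6.c1 dB' δ (ρ₁ - ρ')) *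
          Real.exp (-(ρ' * δ * (geo9K i).dist a b')))) := by
  have hSb : 0 ≤ ∑ j, ‖b j‖ := Finset.sum_nonneg fun _ _ => norm_nonneg _
  have hKX : 0 ≤ (M₂ * ∑ j, ‖b j‖) * (M₂ * ∑ j, ‖b j‖) * B₁ * Λ ^ 4 * B6.c1 dB δ₀ β' ^ 2 *
      (((d : ℝ) + 1) * εD * (2 * (M₂ * (∑ j, ‖b j‖) * BG) + εD)) + ε₃ := by
    have : 0 ≤ M₂ * ∑ j, ‖b j‖ := mul_nonneg hM₂ hSb
    positivity
  -- the transported cube projection IS the cube projection at the gauged-back field (the gauge law of `parS`)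
  have hPl : ∀ c : ↥(cubes i.D.toDomains), locProjBY i c parS (u c) (V c) = DPDsCubeY i c parS (gaugeY i (u c)⁻¹ (V c)) := fun c =>
    locProjBY_eq_DPDsCubeY i c hS (u c) (V c)
  have h1T : ∀ (c : ↥(cubes i.D.toDomains)) (f : FBondY i), |hBdY i (hTY i c) f| ≤ 1 := fun c _ =>
    B6Partition118KLevelTorus.abs_hT_le_one i.D (one_le_Mh i) (B9GeoLemma21KLevelV1.one_le_P i) c _
  -- F3-D2's NEAR binder: F3-B Member §5 at the SWAPPED pair `(h_□, ζ_□̃)`, the window discharged, the `C`-difference word from its (3.49)₄ entry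
  have hXn : ∀ c : ↥(cubes i.D.toDomains), HasMajorant (g := toB6 (geo9K i) Rr Hp) (fun p : FBondY i × ι => ιB (blkV1 i.hN i.D p.1))
      (conj b ((cutMulY (𝔸 := 𝔸) (hBdY i (hTY i c)) * (DPDsY i parS Gp (cfg U₁) - locProjBY i c parS (u c) (V c)) *
        cutMulY (𝔸 := 𝔸) (hBdY i (zetaY i c))).restrictScalars ℝ))
      (fun a y => ((M₂ * ∑ j, ‖b j‖) * (M₂ * ∑ j, ‖b j‖) * B₁ * Λ ^ 4 * B6.c1 dB δ₀ β' ^ 2 *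
          (((d : ℝ) + 1) * εD * (2 * (M₂ * (∑ j, ‖b j‖) * BG) + εD)) + ε₃) *
        ((geo9K i).len a ^ 2)⁻¹ * Real.exp (-(ρ / δ * δ * (geo9K i).dist a y))) := fun c => by
    rw [hPl c]
    refine hasMajorant_mono (g := toB6 (geo9K i) Rr Hp) _
      (hasMajorant_famThree_located_of_cDiff i c b cfg Gp parS hE hBG ιB hι hpar hM₂ hrepr hη hs hB₁ hCinv (χ c) (gaugeY i (u c)⁻¹ (V c))
        hεD (hDL c) (hDR c) (hTY i c) (zetaY i c) (h1T c) (fun f => abs_hBdY_zetaY_le_one i c f) (hhχ c) (hζχ c)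
        (window_hTY i c (u c) (cfg U₁) (V c) (hagree c)) (window_zetaY i c (u c) (cfg U₁) (V c) (hagree c))
        dB hΛ hρ hα hβ hδ₀ hδG' hδX' hδD' hr h261 hT1 hT4
        (hasMajorant_cDiffWord_located_of_entry i b ιB (cfg U₁) (χ c) (hTY i c) (zetaY i c) _ (h1T c) (fun f => abs_hBdY_zetaY_le_one i c f)
          (hhχ c) (hζχ c) (hP3 c)))
      fun a y => le_of_eq ?_
    rw [div_mul_cancel₀ _ hδ.ne']
  have hρn : ρ₁ ≤ ρ / δ := by linarith
  exact hasMajorant_sum_famThreeT_zetaY_of_near_closedP i b cfg par parS Gp hE hBG Oc hB₀ hδ hEO ιB hι hpar hM₂ hrepr hη hs hB₁ RC HC Rr Hp hCinv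
    dB hΛ hρ hα hβ hδ₀ hδG' hδX' hr h261 hT1 hT2 hT4 u hu V dB' dC hKX hKC hδC hαC1 hasep hΛ' hρ' hρn hsplitP hsplitC hsplit h261C h261' hST hXn hPlC

set_option maxHeartbeats 6400000 in
/-- ★★ **AT THE LOCALISED FIELDS OF THE (3.35) DATUM**: `hasMajorant_sum_famThreeT_at_locLetters` with `parS := parSymY i` (def-Y's gauge-law transporters),
`Ṽ_□ := locCfgY i □ η (A □)`, `χ_□ := chiY i □` (plateau hypotheses discharged, `B9Eq3105FamThreeCore` §2), the site agreement DISCHARGED from the datum's `hQ`,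
`hgA` (F3-P `agree_of_datum`) — the `hV′` family-3 summand of `eBlock_kernelFamilyBInv_GAY_of_localInverseCubes''` at G-F2's located projection letters
`Pl □ = locProjBY i □ parSymY (u □) Ṽ_□`, modulo `hDL`∕`hDR`∕`hP3`, the cube datum `hPlC □` (D2a's conclusion shape at `Ṽ_□`) and the letters' blocks.
[cite: Balaban1985BackgroundPropagators, (3.105)–(3.106) p.414, p.415 l.18–37, Cor. 3.6 p.408 («U′ = U^u = e^{iηA}»), p.409 l.1–3, (3.49) p.399, (3.87) p.409; Balaban1983RegularityDecay, (1.11)–(1.12); Balaban1984PropagatorsII, (2.51)–(2.55) p.232, (2.83)–(2.85) pp.237–238, Lemma 2.1 (2.61) p.234] -/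
theorem hasMajorant_sum_famThreeT_at_locCfg
    {BG δG : ℝ} (hE : EBlock (kernelFamilySInv i B cfg Gp (parSymY i)) BG δG U₁) (hBG : 0 ≤ BG)
    (Oc : ↥(cubes i.D.toDomains) → BondOpY 𝔸 i) {B₀ δ : ℝ} (hB₀ : 0 ≤ B₀) (hδ : 0 < δ)
    (hEO : ∀ c : ↥(cubes i.D.toDomains), EBlock (kernelFamilyBInv i B cfg (Oc c) par) B₀ δ U₁)
    (ιB : BlkY i → IBondY i) (hι : ∀ s, β i.hN i.D i.hk (ιB s) = s)
    (hpar : ∀ z w : SiteY i, ‖(parSymY i (cfg U₁) z w : 𝔸)‖ ≤ 1 ∧ ‖(((parSymY i (cfg U₁) z w)⁻¹ : 𝔸ˣ) : 𝔸)‖ ≤ 1)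
    {M₂ : ℝ} (hM₂ : 0 ≤ M₂) (hrepr : ∀ (v : 𝔸) (j : ι), |b.repr v j| ≤ M₂ * ‖v‖) (hη : etaS i = |i.cf|⁻¹)
    {s B₁ δX : ℝ} (hs : (etaS i ^ 2 * etaS i ^ 2) * s = 1) (hB₁ : 0 ≤ B₁)
    (hCinv : HasMajorant (g := toB6 (geo9K i) Rr Hp) (fun q : BlkY i × ι => ιB q.1) (conj b (s • (XinvY i (parSymY i) Gp (cfg U₁)).restrictScalars ℝ))
      (fun a a' => B₁ * ((geo9K i).len a ^ 4)⁻¹ * Real.exp (-(δX * (geo9K i).dist a a'))))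
    (u : ↥(cubes i.D.toDomains) → GaugeY 𝔸 i) (hu : ∀ c x, ‖((u c x : 𝔸ˣ) : 𝔸)‖ ≤ 1 ∧ ‖(((u c x)⁻¹ : 𝔸ˣ) : 𝔸)‖ ≤ 1)
    (A : ↥(cubes i.D.toDomains) → AfldY 𝔸 i)
    (Q : ↥(cubes i.D.toDomains) → Set (Site (PV d ℓ i.m i.K hd hL) 0)) (η : ℝ)
    (hQ : ∀ (c : ↥(cubes i.D.toDomains)) (x : Site (PV d ℓ i.m i.K hd hL) 0), NearC i c (35 * SC i c / 8 + 1) (boxEquiv i.hN x).1 → x ∈ Q c)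
    (hgA : ∀ (c : ↥(cubes i.D.toDomains)) (κ : Fin (d + 1)) (x : Site (PV d ℓ i.m i.K hd hL) 0), x ∈ Q c → x.shift κ ∈ Q c →
      gaugeY i (u c) (cfg U₁) κ x = fluct η (A c) κ x)
    {εD δD : ℝ} (hεD : 0 ≤ εD)
    (hDL : ∀ (c : ↥(cubes i.D.toDomains)) (μ : Fin (d + 1)), HasMajorant (g := toB6 (geo9K i) Rr Hp) (fun p : SiteY i × ι => ιB (blkOf i.D.toDomains p.1))
      (conj b (diffLetter (shiftY i) (UboxY i (cfg U₁)) (((etaS i : ℝ) : ℂ))⁻¹ (Sum.inl μ)) *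
        conj b ((etaS i ^ 2) • (cutMulY (𝔸 := 𝔸) (B9Cor36CubeCutoffs.chiY i c) ∘ₗ
          (Gp (cfg U₁) - GpCubeY i c (parSymY i) (gaugeY i (u c)⁻¹ (locCfgY i c η (A c))))).restrictScalars ℝ))
      (fun a a' => εD * (geo9K i).len a * Real.exp (-(δD * (geo9K i).dist a a'))))
    (hDR : ∀ (c : ↥(cubes i.D.toDomains)) (ν : Fin (d + 1)), HasMajorant (g := toB6 (geo9K i) Rr Hp) (fun p : SiteY i × ι => ιB (blkOf i.D.toDomains p.1))
      (conj b ((etaS i ^ 2) • ((Gp (cfg U₁) - GpCubeY i c (parSymY i) (gaugeY i (u c)⁻¹ (locCfgY i c η (A c)))) ∘ₗ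
          cutMulY (𝔸 := 𝔸) (B9Cor36CubeCutoffs.chiY i c)).restrictScalars ℝ) *
        conj b (diffLetter (shiftY i) (UboxY i (cfg U₁)) (((etaS i : ℝ) : ℂ))⁻¹ (Sum.inr ν)))
      (fun a a' => εD * (geo9K i).len a * Real.exp (-(δD * (geo9K i).dist a a'))))
    (dB : ℕ) {δ₀ δP α β' ρ Λ : ℝ} (hΛ : 1 ≤ Λ) (hρ : 0 ≤ ρ) (hα : 0 ≤ α) (hβ : 0 ≤ β') (hδ₀ : 0 ≤ δ₀)
    (hδG' : δP ≤ δG) (hδX' : δP ≤ δX) (hδD' : δP ≤ δD) (hr : ρ + (2 * α + β') * δ₀ ≤ δP)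
    (h261 : Ineq261 dB (toB6 (geo9K i) Rr Hp) δ₀ β')
    (hT1 : ScaleTransfer (geo9K i) δ₀ α Λ (fun a => (geo9K i).len a)) (hT2 : ScaleTransfer (geo9K i) δ₀ α Λ (fun a => (geo9K i).len a ^ 2))
    (hT4 : ScaleTransfer (geo9K i) δ₀ α Λ (fun a => ((geo9K i).len a ^ 4)⁻¹))
    {ε₃ : ℝ} (hε₃ : 0 ≤ ε₃)
    (hP3 : ∀ c : ↥(cubes i.D.toDomains), HasMajorant (g := toB6 (geo9K i) Rr Hp) (fun p : FBondY i × ι => ιB (blkV1 i.hN i.D p.1))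
      (conj b ((gradY i (cfg U₁) ∘ₗ (cutMulY (𝔸 := 𝔸) (B9Cor36CubeCutoffs.chiY i c) ∘ₗ
        (GpCubeY i c (parSymY i) (gaugeY i (u c)⁻¹ (locCfgY i c η (A c))) ∘ₗ
          ((QpsY i (parSymY i) (cfg U₁) ∘ₗ XinvY i (parSymY i) Gp (cfg U₁) ∘ₗ QpY i (parSymY i) (cfg U₁))
            - (QpsCubeY i c (parSymY i) (gaugeY i (u c)⁻¹ (locCfgY i c η (A c))) ∘ₗ
                XinvCubeY i c (parSymY i) (gaugeY i (u c)⁻¹ (locCfgY i c η (A c))) ∘ₗ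
                QpCubeY i c (parSymY i) (gaugeY i (u c)⁻¹ (locCfgY i c η (A c))))) ∘ₗ
          GpCubeY i c (parSymY i) (gaugeY i (u c)⁻¹ (locCfgY i c η (A c)))) ∘ₗ
        cutMulY (𝔸 := 𝔸) (B9Cor36CubeCutoffs.chiY i c)) ∘ₗ divY i (cfg U₁)).restrictScalars ℝ))
      (fun a y => ε₃ * ((geo9K i).len a ^ 2)⁻¹ * Real.exp (-(ρ * (geo9K i).dist a y))))
    (RC : ℝ) (HC : Prop) (dC : ℕ) {KC δC αC : ℝ} (hKC : 0 ≤ KC) (hδC : 0 ≤ δC) (hαC1 : αC ≤ 1)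
    (h261C : ∀ c : ↥(cubes i.D.toDomains), Ineq261 dC (toB6 (geoCK i c) RC HC) δC αC)
    (hPlC : ∀ c : ↥(cubes i.D.toDomains), HasMajorant (g := toB6 (geoCK i c) RC HC) (blkBK i c)
      (conj b ((DPDsCubeY i c (parSymY i) (locCfgY i c η (A c))).restrictScalars ℝ))
      (fun a s' => KC * ((geoCK i c).len a ^ 2)⁻¹ * Real.exp (-(δC * (geoCK i c).dist a s'))))
    (dB' : ℕ) {asep ρ₁ ρ' αst Λ' : ℝ} (hasep : 0 ≤ asep) (hΛ' : 0 ≤ Λ') (hρ' : 0 ≤ ρ')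
    (hsplitP : asep + ρ₁ ≤ ρ / δ) (hsplitC : asep * δ + ρ₁ * δ ≤ (1 - αC) * δC) (hsplit : αst + ρ' ≤ 1)
    (h261' : Ineq261 dB' (toB6 (geo9K i) Rr Hp) δ (ρ₁ - ρ')) (hST : ScaleTransfer (geo9K i) δ αst Λ' (fun a => ((geo9K i).len a ^ 2)⁻¹)) :
    HasMajorant (g := toB6 (geo9K i) Rr Hp) (fun p : FBondY i × ι => ιB (blkV1 i.hN i.D p.1))
      (∑ c : ↥(cubes i.D.toDomains), conj b ((cutMulY (𝔸 := 𝔸) (hBdY i (hTY i c)) * Oc c (cfg U₁) * cutMulY (𝔸 := 𝔸) (hBdY i (hTY i c)) *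
        (cutMulY (𝔸 := 𝔸) (hBdY i (zetaY i c)) *
          (DPDsY i (parSymY i) Gp (cfg U₁) - locProjBY i c (parSymY i) (u c) (locCfgY i c η (A c))))).restrictScalars ℝ))
      (fun a b' => (3 * 5 ^ (d + 1)) *
        (((M₂ * (∑ j, ‖b j‖) * B₀) *
            ((((M₂ * ∑ j, ‖b j‖) * (M₂ * ∑ j, ‖b j‖) * B₁ * Λ ^ 4 * B6.c1 dB δ₀ β' ^ 2 *
                  (((d : ℝ) + 1) * εD * (2 * (M₂ * (∑ j, ‖b j‖) * BG) + εD)) + ε₃) +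
              (kappa349 (M₂ * ∑ j, ‖b j‖) (((d : ℝ) + 1) * (M₂ * (∑ j, ‖b j‖) * BG)) B₁ Λ (B6.c1 dB δ₀ β') +
                (M₂ * ∑ j, ‖b j‖) ^ 2 * (KC * B6.c1 dC δC αC)) * Real.exp (-(asep * δ * DsepT i)))) * Λ' * B6.c1 dB' δ (ρ₁ - ρ')) *
          Real.exp (-(ρ' * δ * (geo9K i).dist a b')))) :=
  hasMajorant_sum_famThreeT_at_locLetters i b cfg Gp (parSymY i) par (parSymY_isGaugeLawS i) hE hBG Oc hB₀ hδ hEO ιB hι hpar hM₂ hrepr hη hs hB₁ hCinv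
    u hu (fun c => locCfgY i c η (A c)) (fun c w hw κ => agree_of_datum i c (u c) (cfg U₁) (A c) (Q c) η (hQ c) (hgA c) w hw κ)
    (fun c => B9Cor36CubeCutoffs.chiY i c) (fun c _ _ hf hz => chiY_eq_one_of_zetaY_gradK i c hf hz) (fun c _ _ hf hz => chiY_eq_one_of_hTY_gradK i c hf hz)
    hεD hDL hDR dB hΛ hρ hα hβ hδ₀ hδG' hδX' hδD' hr h261 hT1 hT2 hT4 hε₃ hP3 RC HC dC hKC hδC hαC1 h261C hPlC
    dB' hasep hΛ' hρ' hsplitP hsplitC hsplit h261' hST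

end AtLetters

end Literature.MathematicalPhysics.QuantumFieldTheory.Balaban1983to89.B9Eq3105FamThreeTAtLocCfg

end
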